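import Literature.NumberTheory.Automorphic.UnitOrbitalIntegralUnfoldingHK                -- ★ B-p12 (F2): Prop. 5 unfolding
import Literature.NumberTheory.Rogawski1990.UnitOrbitalIntegralInertCountTH              -- ★ A-p03 LAYER B_H (vanishing beyond `N`, block conjugation formulas)
import Literature.NumberTheory.Rogawski1990.UnitOrbitalIntegralInertValuesTH             -- ★ A-p03 values-abstract bridge `finsum_natCast_eq_phiTHM`
import HarnessLib

/-!
# LAYER C, `T_H` clause, COUNTS-ABSTRACT: `#{q ∈ U⧸K : t′ q = q} = phiTHM q N₊ N` from the per-representative counts `#(n, m) = iTen q (N − n) N₊ m` (`n ≤ N`)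
(Flicker (1998), Prop. 5 p. 82, Cor. 9 p. 85, Prop. 10 p. 85, Prop. 11 p. 87)

Topic `NumberTheory/Rogawski1990`; namespace `Literature.NumberTheory.Automorphic.UnitaryGroup`.  THEOREMS ONLY (no `def`, no instance, no notation, no named fact,
no `sorry`); kernel lane.  Cell `pub/hodgecm-mathlib`, road «N7-ns COUNT FROM FLICKER», line «N7nsCount», `stub_irredGValuePos` (κ = +1): this is ★ A-p03 (g24)
`natCard_fixedPoints_unitaryInt_ramifiedTorus_eq_phiTHM` (p841788∕`UnitOrbitalIntegralInertValueTH`) with the per-representative Prop-10 counts ABSTRACTED into a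
hypothesis `hCle` instead of being discharged from `|A − b₀| = |ϖ^{N₊}|` — so that the BOUNDARY case `A = b₀` (`tr δ = 3u`, `N₊ = ∞`; architect A-p06 (g26)
07:09:45Z ruling (R1)) is reached by feeding the boundary variant of the Prop-10 package (B-p04 (g34)) with ANY `N₊ ≥ N + 1` (the values `iTen q ν N₊ m` are constant
in `N₊ > ν`), and the generic case is A-p03's by his ★ even∕odd lemmas.  Proof = A-p03's, verbatim after the abstraction (B-p12 (g28), (R1) TOP half).
HONEST LABEL: HC_CM is proved only modulo the printed citations (2 remaining named inputs hLiu418, h413) until rung 0 closes.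

## References
* [Flicker1998UnitaryFL] Y. Z. Flicker, *Elementary proof of the fundamental lemma for a unitary group*, Canad. J. Math. 50 (1998): Prop. 5 p. 82, Prop. 6 p. 83,
  Cor. 9 p. 85, Prop. 10 p. 85, Prop. 11 p. 87.
* [Rogawski1990] J. D. Rogawski, *Automorphic Representations of Unitary Groups in Three Variables* (1990), §4.9 p. 55.
-/

set_option autoImplicit false

open scoped MatrixGroups WithZero Valued
open Matrix

namespace Literature.NumberTheory.Automorphic

namespace UnitaryGroup

open Literature.NumberTheory.Automorphic.HermitianLattice (unitaryInt mem_unitaryInt_iff LocalConjDatum)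
open Literature.NumberTheory.Rogawski1990.Flicker1998 (iTen phiTHM)
open IsLocalRing

variable {K : Type*} [Field K] [Valued K ℤᵐ⁰] {ϖ : K} (σ : K →+* K) {J : Matrix (Fin 3) (Fin 3) K}

section TH

set_option synthInstance.maxHeartbeats 200000 in
-- the `H`-action on `H ⧸ (K^{u_m} ∩ H)` is found through the large subgroup terms of the `U(2,1)` frame (as in ★ (F2))
/-- **LAYER C, `T_H` clause, COUNTS-ABSTRACT**: for B-p12's ramified torus literal `t′ = !![A,0,Cρ; 0,b₀,0; C,0,A]` (`|ρ| = |ϖ|`, `|C| = |ϖ^N|`) and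
representatives `r(2a)`, `r(2a+1)`: if the Prop-10 counts are `#(n,m) = iTen q (N − n) N₊ m` for `n ≤ N` (`hCle`) and Cor. 9 holds at the ramified torus (`hC9`),
then `#{q ∈ U⧸K : t′ q = q} = phiTHM q N₊ N` (the counts vanish for `n > N` by ★ `natCard_cosets_eq_zero_of_one_lt`; Σ by ★ `finsum_natCast_eq_phiTHM`).
[cite: Flicker1998UnitaryFL, Prop. 5 p. 82, Cor. 9 p. 85, Prop. 10 p. 85, Prop. 11 p. 87] -/
theorem natCard_fixedPoints_unitaryInt_ramifiedTorus_eq_phiTHM_of_counts (hJ : J = (StdForm.antidiagonal 3).over K) (hd : LocalConjDatum σ ϖ)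
    {y : K} (hy : y * σ y = -2)
    {c : ↥(unitaryGroupOfForm σ J)} (hc : ((c : GL (Fin 3) K) : Matrix (Fin 3) (Fin 3) K) = !![1, 0, 0; 0, -1, 0; 0, 0, 1])
    (u : ℕ → ↥(unitaryGroupOfForm σ J))
    (hu : ∀ m, ((u m : GL (Fin 3) K) : Matrix (Fin 3) (Fin 3) K) = !![ϖ ^ m, y, (ϖ ^ m)⁻¹; 0, 1, -σ y * (ϖ ^ m)⁻¹; 0, 0, (ϖ ^ m)⁻¹])
    {t : ↥(unitaryGroupOfForm σ J)} {A B C b₀ ρ : K} (hte : ((t : GL (Fin 3) K) : Matrix (Fin 3) (Fin 3) K) = !![A, 0, B; 0, b₀, 0; C, 0, A])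
    (htH : t ∈ Subgroup.centralizer ({c} : Set ↥(unitaryGroupOfForm σ J))) (hBC : B = C * ρ) (hvρ : Valued.v ρ = Valued.v ϖ)
    {d : K} (hvd : Valued.v d = 1)
    (r : ℕ → ↥(Subgroup.centralizer ({c} : Set ↥(unitaryGroupOfForm σ J))))
    (hr0 : ∀ a : ℕ, (((r (2 * a) : ↥(unitaryGroupOfForm σ J)) : GL (Fin 3) K) : Matrix (Fin 3) (Fin 3) K) = !![(ϖ ^ a)⁻¹, 0, 0; 0, 1, 0; 0, 0, ϖ ^ a])
    (hr1 : ∀ a : ℕ, (((r (2 * a + 1) : ↥(unitaryGroupOfForm σ J)) : GL (Fin 3) K) : Matrix (Fin 3) (Fin 3) K) =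
      !![0, 0, ϖ ^ (a + 1) / d; 0, 1, 0; -d * (ϖ ^ (a + 1))⁻¹, 0, 0])
    {N Np : ℕ} (hvC : Valued.v C = Valued.v (ϖ ^ N)) {q : ℕ} (hq1 : 1 < q)
    (hfin : {x : ↥(unitaryGroupOfForm σ J) ⧸ unitaryInt σ J | t • x = x}.Finite)
    (hC9 : ∀ m, Nat.card {z : ↥(Subgroup.centralizer ({c} : Set ↥(unitaryGroupOfForm σ J))) ⧸
          ((unitaryInt σ J).map (MulAut.conj (u m)).toMonoidHom).subgroupOf (Subgroup.centralizer ({c} : Set ↥(unitaryGroupOfForm σ J))) |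
        (⟨t, htH⟩ : ↥(Subgroup.centralizer ({c} : Set ↥(unitaryGroupOfForm σ J)))) • z = z} =
      ∑ᶠ n : ℕ, q ^ n *
        Nat.card {w : ↥(flickerPH σ J c) ⧸ (flickerHK σ J c (u m)).subgroupOf (flickerPH σ J c) //
          ((Quotient.out w : ↥(flickerPH σ J c)) : ↥(unitaryGroupOfForm σ J))⁻¹ * (((r n : ↥(unitaryGroupOfForm σ J)))⁻¹ * t * (r n)) *
            (Quotient.out w : ↥(flickerPH σ J c)) ∈ flickerHK σ J c (u m)})
    (hCle : ∀ n m : ℕ, n ≤ N →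
      (Nat.card {w : ↥(flickerPH σ J c) ⧸ (flickerHK σ J c (u m)).subgroupOf (flickerPH σ J c) //
          ((Quotient.out w : ↥(flickerPH σ J c)) : ↥(unitaryGroupOfForm σ J))⁻¹ * (((r n : ↥(unitaryGroupOfForm σ J)))⁻¹ * t * (r n)) *
            (Quotient.out w : ↥(flickerPH σ J c)) ∈ flickerHK σ J c (u m)} : ℚ) = iTen q (N - n) Np m) :
    (Nat.card {x : ↥(unitaryGroupOfForm σ J) ⧸ unitaryInt σ J | t • x = x} : ℚ) = phiTHM q Np N := by
  have hϖ0 : ϖ ≠ 0 := hd.ϖ_ne_zero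
  have hd0 : d ≠ 0 := fun h => by rw [h, map_zero] at hvd; exact zero_ne_one hvd
  -- the count of one summand
  set Cn : ℕ → ℕ → ℕ := fun n m => Nat.card {w : ↥(flickerPH σ J c) ⧸ (flickerHK σ J c (u m)).subgroupOf (flickerPH σ J c) //
      ((Quotient.out w : ↥(flickerPH σ J c)) : ↥(unitaryGroupOfForm σ J))⁻¹ * (((r n : ↥(unitaryGroupOfForm σ J)))⁻¹ * t * (r n)) *
        (Quotient.out w : ↥(flickerPH σ J c)) ∈ flickerHK σ J c (u m)} with hCn
  replace hCle : ∀ n m, n ≤ N → (Cn n m : ℚ) = iTen q (N - n) Np m := fun n m hn => hCle n m hn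
  have hCbig : ∀ n m, N < n → Cn n m = 0 := by
    intro n m hn
    have hτH : ((r n : ↥(unitaryGroupOfForm σ J)))⁻¹ * t * (r n) ∈ Subgroup.centralizer ({c} : Set ↥(unitaryGroupOfForm σ J)) :=
      Subgroup.mul_mem _ (Subgroup.mul_mem _ (Subgroup.inv_mem _ (r n).2) htH) (r n).2
    obtain ⟨a, rfl | rfl⟩ := Nat.even_or_odd' n
    · have hpa : ϖ ^ a ≠ 0 := pow_ne_zero _ hϖ0
      refine natCard_cosets_eq_zero_of_one_lt σ hJ hd hy m hc (hu m) (coe_diag_inv_mul_block_mul_diag σ hpa hte (hr0 a)) hτH ?_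
      rw [map_mul, map_mul, map_inv₀, hvC, hd.v_pow, hd.v_pow, ← WithZero.exp_neg, ← WithZero.exp_add, ← WithZero.exp_add, ← WithZero.exp_zero,
        WithZero.exp_lt_exp]; omega
    · have hpa : ϖ ^ (a + 1) ≠ 0 := pow_ne_zero _ hϖ0
      have hx : ϖ ^ (a + 1) / d ≠ 0 := div_ne_zero hpa hd0
      have hz : -d * (ϖ ^ (a + 1))⁻¹ ≠ 0 := mul_ne_zero (neg_ne_zero.2 hd0) (inv_ne_zero hpa)
      have hC : C ≠ 0 := fun h => by rw [h, map_zero] at hvC; exact (pow_ne_zero _ hϖ0) ((map_eq_zero _).1 hvC.symm)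
      refine natCard_cosets_eq_zero_of_one_lt σ hJ hd hy m hc (hu m) (coe_antidiag_inv_mul_block_mul_antidiag σ hx hz hte (hr1 a)) hτH ?_
      rw [map_div₀, map_mul, map_mul, Valuation.map_neg, map_inv₀, map_div₀, hvd, one_mul, div_one, hBC, map_mul, hvC, hvρ, hd.v_pow, hd.v_pow,
        hd.vϖ, ← WithZero.exp_neg, ← WithZero.exp_add, ← WithZero.exp_add, ← WithZero.exp_sub, ← WithZero.exp_zero, WithZero.exp_lt_exp]; omega
  -- the values-abstract `I`
  set I : ℕ → ℕ → ℚ := fun n m => if n ≤ N then iTen q (N - n) Np m else 0 with hI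
  have hle : ∀ n m, n ≤ N → I n m = iTen q (N - n) Np m := fun n m hn => by rw [hI]; exact if_pos hn
  have hbig : ∀ n m, N < n → I n m = 0 := fun n m hn => by rw [hI]; exact if_neg (by omega)
  -- the level-`m` count `A m`
  set Am : ℕ → ℕ := fun m => Nat.card {z : ↥(Subgroup.centralizer ({c} : Set ↥(unitaryGroupOfForm σ J))) ⧸
      ((unitaryInt σ J).map (MulAut.conj (u m)).toMonoidHom).subgroupOf (Subgroup.centralizer ({c} : Set ↥(unitaryGroupOfForm σ J))) |
    (⟨t, htH⟩ : ↥(Subgroup.centralizer ({c} : Set ↥(unitaryGroupOfForm σ J)))) • z = z} with hAdef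
  have hsuppC : ∀ m, (Function.support fun n : ℕ => q ^ n * Cn n m).Finite := by
    intro m
    refine (Set.finite_Iio (N + 1)).subset fun n hn => ?_
    by_contra hle'
    simp only [Set.mem_Iio, not_lt] at hle'
    exact hn (by dsimp only; rw [hCbig n m (by omega), mul_zero])
  have hA : ∀ m, (Am m : ℚ) = ∑ᶠ n, (q : ℚ) ^ n * I n m := by
    intro m
    rw [hAdef]; dsimp only
    have hcastC := (Nat.castAddMonoidHom ℚ).map_finsum (hsuppC m)
    simp only [Nat.coe_castAddMonoidHom] at hcastC
    rw [hC9 m]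
    change ((∑ᶠ n : ℕ, q ^ n * Cn n m : ℕ) : ℚ) = _
    rw [hcastC]
    refine finsum_congr fun n => ?_
    rw [Nat.cast_mul, Nat.cast_pow]
    by_cases hn : n ≤ N
    · rw [hle _ m hn, ← hCle n m hn]
    · rw [hbig _ m (by omega), hCbig n m (by omega), Nat.cast_zero]
  have hsuppA : (Function.support Am).Finite := by
    refine (finite_setOf_nonempty_fixedPoints_flickerU σ hJ hd hy hc u hu htH hfin).1.subset fun m hm => ?_
    by_contra hne
    apply hm
    rw [hAdef]; dsimp only
    simp only [Set.mem_setOf_eq, not_nonempty_iff] at hne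
    exact @Nat.card_of_isEmpty _ hne
  have hcast := (Nat.castAddMonoidHom ℚ).map_finsum hsuppA
  simp only [Nat.coe_castAddMonoidHom] at hcast
  rw [natCard_fixedPoints_unitaryInt_eq_finsum_flickerU σ hJ hd hy hc u hu htH hfin]
  change ((∑ᶠ m, Am m : ℕ) : ℚ) = _
  rw [hcast]
  exact Rogawski1990.Flicker1998.finsum_natCast_eq_phiTHM q I hle hbig hq1 Am hA

end TH

end UnitaryGroup

end Literature.NumberTheory.Automorphic
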